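import Summits.AtomisticToContinuum.HydrodynamicLimit.Theorems.OneFlightGossipEngineEquilibriumClampedCollisionalWindowLDAdaptedClampKinematics
import Literature.MathematicalPhysics.KineticTheory.CollisionTubePullbackGeometry
import Literature.MathematicalPhysics.KineticTheory.CollisionTubePullbackFlight

/-!
# Rung R7 of line `Sketch`, legs of isolated records (crux `TwoClocks.ClampedTransferWindowLD`, stmt-AtomisticToContinuum-16623)

Helper file (`--supports stmt-AtomisticToContinuum-16623`) for the registered stub `SketchLine.stub_isolatedShellDomination`
(R7 of the lead-owned skeleton `Cruxes/ClampedTransferWindowLD/Lines/Sketch.lean`, v4; card `Ideas/clamp-price-static-shell.md`,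
first lemma `IsolatedShellDomination`): the deterministic two-body facts about ONE isolated binary record along a good orbit of
`N + 1` hard spheres of diameter `ε = hsDiameter σ N < 1/8` on `𝕋³`.

Fix a record `c` of the ordered pair `(i, j)` at the collision time `t_c`, with incoming relative velocity
`g = v_i⁻ - v_j⁻ ≠ 0`, leg window `[t₀, t_c]`, `t₀ = t_c - 2ε/‖g‖`, and the ISOLATION hypothesis of the stub: no third
sphere comes within `3ε` of `i` or of `j` during `[t₀, t_c]`.

* `isoShell_mem_contactPairs_of_isolated` — under isolation at a time `a`, a collision of `i` or of `j` at `a` is a collision of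
  the pair `(i, j)` (a contact is a separation `ε < 3ε`).
* `isoShell_free` — **the partners fly freely on `(t₀, t_c)`**: the later of the two flight starts of `i`, `j` from `t₀` would be
  a collision of the pair (isolation), after which the pair is OUTGOING (`IsHardSphereTrajectory.isOutgoing_of_mem_contactSet`)
  and flies freely up to `t_c` (`sepAt_orbit_eq`: the minimal image follows the flight, everything stays below `3ε < 1/2`), so its
  separation at `t_c` would exceed `ε` (`isoShell_lt_norm_add_smul`) — but `t_c` is a contact.
* `isoShell_leg` — **the leg**: for `s ∈ (t_c - ε/‖g‖, t_c)` the velocities of `i`, `j` are the incoming ones `v_i⁻, v_j⁻`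
  (`reflectVel_orbit_eq`, `orbit_vels_eq`) and `ε < ‖sep(x_i(s), x_j(s))‖ < 2ε` (backward flight `ε n - u g`, `⟪n, g⟫ < 0`:
  `tube_backward` and the triangle inequality) — particle `j` sits in the near-contact shell of `i`.
* `isoShell_impulse_le` — `impulse c ≤ ‖g‖ (1 + ‖v_i⁻ + v_j⁻‖/2)` (`‖Δv_i‖ ≤ ‖g‖`, `‖v_i⁺‖² - ‖v_i⁻‖² = ⟪v_i⁻ + v_j⁻, Δv_i⟫`;
  record algebra of `…AdaptedClampKinematics`).

References: C. Cercignani, R. Illner, M. Pulvirenti, *The Mathematical Theory of Dilute Gases* (1994), §2.2, §4.2;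
I. Gallagher, L. Saint-Raymond, B. Texier, *From Newton to Boltzmann* (2013), §4.1.
-/

noncomputable section

open MeasureTheory ProbabilityTheory Set Filter
open scoped ENNReal BigOperators InnerProductSpace
open Literature.Analysis.FluidPDE Literature.MathematicalPhysics.KineticTheory
open Literature.Analysis.FunctionSpaces (Torus.partialDeriv Torus.IsSmooth)

namespace Summit.AtomisticToContinuum.HydrodynamicLimit.Theorems.ClampedTransferCoin.SketchLine

open HardSphereCollisionRecord

/-! ## Two-body kinematics -/

section Kinematics

variable {E : Type*} [NormedAddCommGroup E] [InnerProductSpace ℝ E]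

/-- Backward free flight from an INCOMING contact leaves the contact sphere at once: `‖n‖ = ε`, `⟪n, g⟫ < 0`, `0 < u` give
`ε < ‖n - u • g‖`. -/
theorem isoShell_lt_norm_sub_smul {n g : E} {ε u : ℝ} (hn : ‖n‖ = ε) (hin : ⟪n, g⟫_ℝ < 0) (hu : 0 < u) :
    ε < ‖n - u • g‖ :=
  (tube_backward hn hin hu).1

/-- Forward free flight from an OUTGOING contact leaves the contact sphere at once: `‖n‖ = ε`, `0 < ⟪n, g⟫`, `0 < u` give
`ε < ‖n + u • g‖`. -/
theorem isoShell_lt_norm_add_smul {n g : E} {ε u : ℝ} (hn : ‖n‖ = ε) (hout : 0 < ⟪n, g⟫_ℝ) (hu : 0 < u) :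
    ε < ‖n + u • g‖ := by
  have hin : ⟪n, -g⟫_ℝ < 0 := by rwa [inner_neg_right, neg_lt_zero]
  simpa [smul_neg, sub_neg_eq_add] using (tube_backward hn hin hu).1

/-- The backward flight stays within `ε + u ‖g‖` of the partner: `‖n - u • g‖ ≤ ε + u ‖g‖` (`‖n‖ = ε`, `0 ≤ u`). -/
theorem isoShell_norm_sub_smul_le {n g : E} {ε u : ℝ} (hn : ‖n‖ = ε) (hu : 0 ≤ u) :
    ‖n - u • g‖ ≤ ε + u * ‖g‖ := by
  calc ‖n - u • g‖ ≤ ‖n‖ + ‖u • g‖ := norm_sub_le _ _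
    _ = ε + u * ‖g‖ := by rw [hn, norm_smul, Real.norm_of_nonneg hu]

end Kinematics

/-- **Impulse bound.** For a record whose post-velocities are the elastic reflection of its pre-velocities (every `ofConfig`
record), `impulse c ≤ ‖g‖ (1 + ‖v⁻ + w⁻‖/2)` with `g = v⁻ - w⁻`: `‖Δv‖ ≤ ‖g‖` and `‖v⁺‖² - ‖v⁻‖² = ⟪v⁻ + w⁻, Δv⟫`. -/
theorem isoShell_impulse_le {N : ℕ} (c : Rec N) {n : V3} (hc : c.postVel = reflectVel n c.preVel) :
    impulse c ≤ ‖c.preVel.1 - c.preVel.2‖ * (1 + ‖c.preVel.1 + c.preVel.2‖ / 2) := by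
  have h1 : ‖c.postVel.1 - c.preVel.1‖ ≤ ‖c.preVel.1 - c.preVel.2‖ := by
    rw [hc]
    exact AdaptedClampKinematics.norm_reflectVel_fst_sub_le n c.preVel
  have h2 : |‖c.postVel.1‖ ^ 2 - ‖c.preVel.1‖ ^ 2| ≤ ‖c.preVel.1 + c.preVel.2‖ * ‖c.preVel.1 - c.preVel.2‖ := by
    rw [hc, AdaptedClampKinematics.norm_sq_reflectVel_fst_sub n c.preVel]
    calc |inner ℝ (c.preVel.1 + c.preVel.2) ((reflectVel n c.preVel).1 - c.preVel.1)|
        ≤ ‖c.preVel.1 + c.preVel.2‖ * ‖(reflectVel n c.preVel).1 - c.preVel.1‖ := abs_real_inner_le_norm _ _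
      _ ≤ ‖c.preVel.1 + c.preVel.2‖ * ‖c.preVel.1 - c.preVel.2‖ :=
        mul_le_mul_of_nonneg_left (AdaptedClampKinematics.norm_reflectVel_fst_sub_le n c.preVel) (norm_nonneg _)
  have h3 : ‖c.preVel.1 - c.preVel.2‖ * (1 + ‖c.preVel.1 + c.preVel.2‖ / 2) =
      ‖c.preVel.1 - c.preVel.2‖ + ‖c.preVel.1 + c.preVel.2‖ * ‖c.preVel.1 - c.preVel.2‖ / 2 := by
    ring
  unfold impulse
  rw [h3]
  linarith

/-! ## One isolated record along a good orbit -/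

section Legs

variable {σ : ℝ} {N : ℕ} {Φ : Flow σ N} {z : Phase N}


/-- **Isolation pins the partner.** If no third sphere is within `3ε` of `i` or of `j` in the configuration `Φ_a z` of a good
orbit (`0 < ε < 1/2`), then any collision of `i` or of `j` at time `a` is a collision of the ordered pair `(i, j)`. -/
theorem isoShell_mem_contactPairs_of_isolated (hz : z ∈ Φ.good) (hε : 0 < hsDiameter σ N)
    (hε2 : hsDiameter σ N < 2⁻¹) {i j : Fin (N + 1)} {a : ℝ}
    (hiso : ∀ k : Fin (N + 1), k ≠ i → k ≠ j →
      3 * hsDiameter σ N < ‖(Torus.geometry (Fin 3)).sepVec (Φ.flow a z k).1 (Φ.flow a z i).1‖ ∧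
      3 * hsDiameter σ N < ‖(Torus.geometry (Fin 3)).sepVec (Φ.flow a z k).1 (Φ.flow a z j).1‖)
    (hpart : Participates (Torus.geometry (Fin 3)) (hsDiameter σ N) (Φ.flow a z) i ∨
      Participates (Torus.geometry (Fin 3)) (hsDiameter σ N) (Φ.flow a z) j) :
    (i, j) ∈ contactPairs (Torus.geometry (Fin 3)) (hsDiameter σ N) (Φ.flow a z) := by
  have hG := Torus.isHardSphereRegular_geometry (d := Fin 3) hε2
  have hdom : Φ.flow a z ∈ hardSphereDomain (Torus.geometry (Fin 3)) (N + 1) (hsDiameter σ N) := (Φ.isTrajectory z hz).mem a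
  -- a contact of `m` with `l` is a separation `‖sep x_l x_m‖ = ε`
  have key : ∀ {m l : Fin (N + 1)}, Collide (Torus.geometry (Fin 3)) (hsDiameter σ N) (Φ.flow a z) m l →
      ‖(Torus.geometry (Fin 3)).sepVec (Φ.flow a z l).1 (Φ.flow a z m).1‖ = hsDiameter σ N := by
    intro m l hml
    rcases hml with h | h
    · have h' : ‖(Torus.geometry (Fin 3)).sepVec (Φ.flow a z m).1 (Φ.flow a z l).1‖ = hsDiameter σ N :=
        ((mem_contactPairs_iff_of_mem hdom).1 h).2
      rw [hG.norm_sepVec_comm_of_le h'.le]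
      exact h'
    · exact ((mem_contactPairs_iff_of_mem hdom).1 h).2
  rcases hpart with ⟨l, hl⟩ | ⟨l, hl⟩
  · have hlj : l = j := by
      by_contra hlj
      have h3 := (hiso l hl.ne.symm hlj).1
      rw [key hl] at h3
      linarith
    subst hlj
    rcases hl with h | h
    · exact h
    · exact (swap_mem_contactPairs_iff hG (p := (i, l))).1 h
  · have hli : l = i := by
      by_contra hli
      have h3 := (hiso l hli hl.ne.symm).2
      rw [key hl] at h3
      linarith
    subst hli
    rcases hl with h | h
    · exact (swap_mem_contactPairs_iff hG (p := (l, j))).1 h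
    · exact h

/-- **The partners of an isolated record fly freely on its leg window.** Let `c` be the record of the ordered pair `(i, j)`
at the collision time `t_c` of a good orbit (`ε = hsDiameter σ N < 1/8`), with incoming relative velocity `g = v_i⁻ - v_j⁻ ≠ 0`,
`t₀ = t_c - 2ε/‖g‖`, and suppose no third sphere is within `3ε` of `i` or of `j` during `[t₀, t_c]`. Then neither `i` nor `j`
takes part in a collision during `(t₀, t_c)`: the later flight start `a ∈ (t₀, t_c)` of the two would be a collision of the pair,
after which the outgoing pair flies freely to `t_c` with separation `> ε` — but `t_c` is a contact. -/
theorem isoShell_free (hz : z ∈ Φ.good) (hσ : 0 < σ) (hε8 : hsDiameter σ N < 8⁻¹) {i j : Fin (N + 1)} {tc : ℝ}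
    (hp : (i, j) ∈ contactPairs (Torus.geometry (Fin 3)) (hsDiameter σ N) (Φ.flow tc z)) {c : Rec N}
    (hc : c = ofConfig (Torus.geometry (Fin 3)) (hsDiameter σ N) (Φ.flow tc z) tc i j) {g : V3} (hgc : c.preVel.1 - c.preVel.2 = g)
    (hg : 0 < ‖g‖) {t0 : ℝ} (ht0 : t0 = tc - 2 * hsDiameter σ N / ‖g‖)
    (hiso : ∀ k : Fin (N + 1), k ≠ i → k ≠ j → ∀ t ∈ Icc t0 tc,
      3 * hsDiameter σ N < ‖(Torus.geometry (Fin 3)).sepVec (Φ.flow t z k).1 (Φ.flow t z i).1‖ ∧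
      3 * hsDiameter σ N < ‖(Torus.geometry (Fin 3)).sepVec (Φ.flow t z k).1 (Φ.flow t z j).1‖)
    {u : ℝ} (hu : u ∈ Ioo t0 tc) :
    ¬ Participates (Torus.geometry (Fin 3)) (hsDiameter σ N) (Φ.flow u z) i ∧
      ¬ Participates (Torus.geometry (Fin 3)) (hsDiameter σ N) (Φ.flow u z) j := by
  have hε : 0 < hsDiameter σ N := hsDiameter_pos hσ N
  have hε2 : hsDiameter σ N < 2⁻¹ := hε8.trans (by norm_num)
  have htraj := Φ.isTrajectory z hz
  have hij : i ≠ j := (mem_contactPairs.1 hp).1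
  have hr0 : 0 < 2 * hsDiameter σ N / ‖g‖ := div_pos (by linarith) hg
  have ht0c : t0 < tc := by rw [ht0]; linarith
  have hfi := htraj.finite_collisionTimesOf_inter_Ioo i t0 tc
  have hfj := htraj.finite_collisionTimesOf_inter_Ioo j t0 tc
  -- the later of the two flight starts from `t0`
  set a := max (flightStart (Torus.geometry (Fin 3)) (hsDiameter σ N) (fun t => Φ.flow t z) t0 i tc)
    (flightStart (Torus.geometry (Fin 3)) (hsDiameter σ N) (fun t => Φ.flow t z) t0 j tc) with ha
  have ht0a : t0 ≤ a := (le_flightStart hfi).trans (le_max_left _ _)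
  have hatc : a < tc := max_lt (flightStart_lt hfi ht0c) (flightStart_lt hfj ht0c)
  have hfree_i : ∀ v ∈ Ioo a tc, ¬ Participates (Torus.geometry (Fin 3)) (hsDiameter σ N) (Φ.flow v z) i := fun v hv =>
    not_participates_of_mem_Ioo_flightStart hfi ⟨(le_max_left _ _).trans_lt hv.1, hv.2⟩
  have hfree_j : ∀ v ∈ Ioo a tc, ¬ Participates (Torus.geometry (Fin 3)) (hsDiameter σ N) (Φ.flow v z) j := fun v hv =>
    not_participates_of_mem_Ioo_flightStart hfj ⟨(le_max_right _ _).trans_lt hv.1, hv.2⟩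
  -- it suffices that `a = t0`
  suffices hat0 : a = t0 by
    rw [hat0] at hfree_i hfree_j
    exact ⟨hfree_i u hu, hfree_j u hu⟩
  by_contra hne
  have hlt : t0 < a := lt_of_le_of_ne ht0a (Ne.symm hne)
  -- `a` is then a participation time of `i` or of `j`
  have hpart : Participates (Torus.geometry (Fin 3)) (hsDiameter σ N) (Φ.flow a z) i ∨
      Participates (Torus.geometry (Fin 3)) (hsDiameter σ N) (Φ.flow a z) j := by
    rcases le_total (flightStart (Torus.geometry (Fin 3)) (hsDiameter σ N) (fun t => Φ.flow t z) t0 i tc)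
        (flightStart (Torus.geometry (Fin 3)) (hsDiameter σ N) (fun t => Φ.flow t z) t0 j tc) with h | h
    · have haj : a = flightStart (Torus.geometry (Fin 3)) (hsDiameter σ N) (fun t => Φ.flow t z) t0 j tc := max_eq_right h
      rcases mem_insert_iff.1 (flightStart_mem hfj) with h0 | hm
      · exact absurd (haj.trans h0) hlt.ne'
      · exact Or.inr (haj ▸ hm.1)
    · have hai : a = flightStart (Torus.geometry (Fin 3)) (hsDiameter σ N) (fun t => Φ.flow t z) t0 i tc := max_eq_left h
      rcases mem_insert_iff.1 (flightStart_mem hfi) with h0 | hm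
      · exact absurd (hai.trans h0) hlt.ne'
      · exact Or.inl (hai ▸ hm.1)
  -- isolation: the collision at `a` is one of the pair, which is outgoing afterwards
  have hpa : (i, j) ∈ contactPairs (Torus.geometry (Fin 3)) (hsDiameter σ N) (Φ.flow a z) :=
    isoShell_mem_contactPairs_of_isolated hz hε hε2 (fun k hki hkj => hiso k hki hkj a ⟨hlt.le, hatc.le⟩) hpart
  have hna : ‖sepAt (Φ.flow a z) i j‖ = hsDiameter σ N := ((mem_contactPairs_iff_of_mem (htraj.mem a)).1 hpa).2
  have hout : 0 < ⟪sepAt (Φ.flow a z) i j, relVel (Φ.flow a z) i j⟫_ℝ :=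
    htraj.isOutgoing_of_mem_contactSet hij (mem_contactPairs.1 hpa).2
  -- the incoming velocities at `tc` are the flight velocities from `a`
  have hpre := reflectVel_orbit_eq hz hatc hfree_i hfree_j hp
  simp only [Literature.MathematicalPhysics.KineticTheory.orbit_apply, sepAt] at hpre
  have hgrel : g = relVel (Φ.flow a z) i j := by
    rw [← hgc, hc, ofConfig_preVel, hpre]
    rfl
  -- fly from `a` to `tc`: the minimal image follows (everything stays below `3 ε < 1 / 2`)
  have hsmall : ‖sepAt (Φ.flow a z) i j + (tc - a) • relVel (Φ.flow a z) i j‖ < 1 / 2 := by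
    have h1 : ‖(tc - a) • relVel (Φ.flow a z) i j‖ ≤ 2 * hsDiameter σ N := by
      rw [← hgrel, norm_smul, Real.norm_of_nonneg (sub_nonneg.2 hatc.le)]
      calc (tc - a) * ‖g‖ ≤ (tc - t0) * ‖g‖ := mul_le_mul_of_nonneg_right (by linarith) hg.le
        _ = 2 * hsDiameter σ N := by rw [ht0]; field_simp; ring
    have h8 : (8 : ℝ)⁻¹ = 1 / 8 := by norm_num
    calc ‖sepAt (Φ.flow a z) i j + (tc - a) • relVel (Φ.flow a z) i j‖
        ≤ ‖sepAt (Φ.flow a z) i j‖ + ‖(tc - a) • relVel (Φ.flow a z) i j‖ := norm_add_le _ _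
      _ ≤ hsDiameter σ N + 2 * hsDiameter σ N := add_le_add hna.le h1
      _ < 1 / 2 := by linarith
  have hsep := sepAt_orbit_eq hz hatc.le hfree_i hfree_j (t := a) (t' := tc) ⟨le_rfl, hatc.le⟩
    ⟨hatc.le, le_rfl⟩ hsmall
  simp only [Literature.MathematicalPhysics.KineticTheory.orbit_apply] at hsep
  have hntc : ‖sepAt (Φ.flow tc z) i j‖ = hsDiameter σ N :=
    ((mem_contactPairs_iff_of_mem (htraj.mem tc)).1 hp).2
  have hgt := isoShell_lt_norm_add_smul hna hout (sub_pos.2 hatc)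
  rw [← hsep, hntc] at hgt
  exact lt_irrefl _ hgt

/-- **The leg of an isolated record.** In the setting of `isoShell_free`, for every `s ∈ (t_c - ε/‖g‖, t_c)` the partner `j`
sits in the near-contact shell of `i`, `ε < ‖sep(x_i(s), x_j(s))‖ < 2ε`, and both velocities are the incoming ones:
`v_i(s) = v_i⁻`, `v_j(s) = v_j⁻` (free backward flight `ε n - u g`, `0 < u < ε/‖g‖`, from the incoming contact `⟪n, g⟫ < 0`). -/
theorem isoShell_leg (hz : z ∈ Φ.good) (hσ : 0 < σ) (hε8 : hsDiameter σ N < 8⁻¹) {i j : Fin (N + 1)} {tc : ℝ}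
    (hp : (i, j) ∈ contactPairs (Torus.geometry (Fin 3)) (hsDiameter σ N) (Φ.flow tc z)) {c : Rec N}
    (hc : c = ofConfig (Torus.geometry (Fin 3)) (hsDiameter σ N) (Φ.flow tc z) tc i j) {g : V3} (hgc : c.preVel.1 - c.preVel.2 = g)
    (hg : 0 < ‖g‖) {t0 : ℝ} (ht0 : t0 = tc - 2 * hsDiameter σ N / ‖g‖)
    (hiso : ∀ k : Fin (N + 1), k ≠ i → k ≠ j → ∀ t ∈ Icc t0 tc,
      3 * hsDiameter σ N < ‖(Torus.geometry (Fin 3)).sepVec (Φ.flow t z k).1 (Φ.flow t z i).1‖ ∧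
      3 * hsDiameter σ N < ‖(Torus.geometry (Fin 3)).sepVec (Φ.flow t z k).1 (Φ.flow t z j).1‖)
    {s : ℝ} (hs : s ∈ Ioo (tc - hsDiameter σ N / ‖g‖) tc) :
    hsDiameter σ N < ‖(Torus.geometry (Fin 3)).sepVec (Φ.flow s z i).1 (Φ.flow s z j).1‖ ∧
      ‖(Torus.geometry (Fin 3)).sepVec (Φ.flow s z i).1 (Φ.flow s z j).1‖ < 2 * hsDiameter σ N ∧
      (Φ.flow s z i).2 = c.preVel.1 ∧ (Φ.flow s z j).2 = c.preVel.2 := by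
  have hε : 0 < hsDiameter σ N := hsDiameter_pos hσ N
  have htraj := Φ.isTrajectory z hz
  have hr0 : 0 < hsDiameter σ N / ‖g‖ := div_pos hε hg
  have ht0c : t0 < tc := by
    rw [ht0]
    have := div_pos (by linarith : (0 : ℝ) < 2 * hsDiameter σ N) hg
    linarith
  have ht0s : t0 < s := by
    have h2 : tc - 2 * hsDiameter σ N / ‖g‖ < tc - hsDiameter σ N / ‖g‖ := by
      rw [mul_div_assoc]
      linarith
    rw [ht0]
    exact h2.trans hs.1
  have hfree_i : ∀ v ∈ Ioo t0 tc, ¬ Participates (Torus.geometry (Fin 3)) (hsDiameter σ N) (Φ.flow v z) i := fun v hv =>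
    (isoShell_free hz hσ hε8 hp hc hgc hg ht0 hiso hv).1
  have hfree_j : ∀ v ∈ Ioo t0 tc, ¬ Participates (Torus.geometry (Fin 3)) (hsDiameter σ N) (Φ.flow v z) j := fun v hv =>
    (isoShell_free hz hσ hε8 hp hc hgc hg ht0 hiso hv).2
  -- the incoming velocities are the flight velocities from `t0`
  have hpre := reflectVel_orbit_eq hz ht0c hfree_i hfree_j hp
  simp only [Literature.MathematicalPhysics.KineticTheory.orbit_apply, sepAt] at hpre
  have hcpre : c.preVel = ((Φ.flow t0 z i).2, (Φ.flow t0 z j).2) := by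
    rw [hc, ofConfig_preVel]
    exact hpre
  have hgrel : relVel (Φ.flow t0 z) i j = g := by
    rw [← hgc, hcpre]
    rfl
  -- velocities on the leg
  obtain ⟨hvi, hvj, -⟩ := orbit_vels_eq hz hfree_i hfree_j (t := s) ⟨ht0s.le, hs.2⟩
  simp only [Literature.MathematicalPhysics.KineticTheory.orbit_apply] at hvi hvj
  -- separation on the leg: fly back from the incoming contact at `tc`
  have hntc : ‖sepAt (Φ.flow tc z) i j‖ = hsDiameter σ N :=
    ((mem_contactPairs_iff_of_mem (htraj.mem tc)).1 hp).2
  have hin : ⟪sepAt (Φ.flow tc z) i j, g⟫_ℝ < 0 := by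
    have h := htraj.inner_sepVec_preVel_neg hp
    rw [← hc, hgc] at h
    exact h
  have hus0 : 0 < tc - s := by linarith [hs.2]
  have hflt : ‖sepAt (Φ.flow tc z) i j - (tc - s) • g‖ < 2 * hsDiameter σ N := by
    have h1 : (tc - s) * ‖g‖ < hsDiameter σ N / ‖g‖ * ‖g‖ :=
      mul_lt_mul_of_pos_right (by linarith [hs.1]) hg
    rw [div_mul_cancel₀ _ hg.ne'] at h1
    calc ‖sepAt (Φ.flow tc z) i j - (tc - s) • g‖ ≤ hsDiameter σ N + (tc - s) * ‖g‖ :=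
        isoShell_norm_sub_smul_le hntc hus0.le
      _ < 2 * hsDiameter σ N := by linarith
  have heq : sepAt (Φ.flow tc z) i j + (s - tc) • relVel (Φ.flow t0 z) i j =
      sepAt (Φ.flow tc z) i j - (tc - s) • g := by
    rw [hgrel, show s - tc = -(tc - s) by ring, neg_smul, ← sub_eq_add_neg]
  have hsmall : ‖sepAt (Φ.flow tc z) i j + (s - tc) • relVel (Φ.flow t0 z) i j‖ < 1 / 2 := by
    rw [heq]
    have h8 : (8 : ℝ)⁻¹ = 1 / 8 := by norm_num
    linarith
  have hsep := sepAt_orbit_eq hz ht0c.le hfree_i hfree_j (t := tc) (t' := s) ⟨ht0c.le, le_rfl⟩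
    ⟨ht0s.le, hs.2.le⟩ hsmall
  simp only [Literature.MathematicalPhysics.KineticTheory.orbit_apply] at hsep
  rw [heq] at hsep
  refine ⟨?_, ?_, ?_, ?_⟩
  · show hsDiameter σ N < ‖sepAt (Φ.flow s z) i j‖
    rw [hsep]
    exact isoShell_lt_norm_sub_smul hntc hin hus0
  · show ‖sepAt (Φ.flow s z) i j‖ < 2 * hsDiameter σ N
    rw [hsep]
    exact hflt
  · rw [hvi, hcpre]
  · rw [hvj, hcpre]

/-- **Registered sub-goal `isoShell_legFacts`** (closed form of `isoShell_leg`, the interface consumed by the stub file): on the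
leg `(t_c - ε/‖g‖, t_c)` of an isolated record of `(i, j)` the partner `j` is in the near-contact shell of `i`,
`ε < ‖sep(x_i, x_j)‖ < 2ε`, and both velocities are the incoming ones. -/
theorem isoShell_legFacts :
    ∀ (σ : ℝ) (N : ℕ) (Φ : Flow σ N) (z : Phase N), z ∈ Φ.good → 0 < σ → hsDiameter σ N < 8⁻¹ →
      ∀ (i j : Fin (N + 1)) (tc : ℝ) (c : Rec N) (g : V3),
        (i, j) ∈ contactPairs (Torus.geometry (Fin 3)) (hsDiameter σ N) (Φ.flow tc z) →
        c = HardSphereCollisionRecord.ofConfig (Torus.geometry (Fin 3)) (hsDiameter σ N) (Φ.flow tc z) tc i j →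
        c.preVel.1 - c.preVel.2 = g → 0 < ‖g‖ →
        (∀ k : Fin (N + 1), k ≠ i → k ≠ j → ∀ t ∈ Set.Icc (tc - 2 * hsDiameter σ N / ‖g‖) tc,
          3 * hsDiameter σ N < ‖(Torus.geometry (Fin 3)).sepVec (Φ.flow t z k).1 (Φ.flow t z i).1‖ ∧
          3 * hsDiameter σ N < ‖(Torus.geometry (Fin 3)).sepVec (Φ.flow t z k).1 (Φ.flow t z j).1‖) →
        ∀ s ∈ Set.Ioo (tc - hsDiameter σ N / ‖g‖) tc,
          hsDiameter σ N < ‖(Torus.geometry (Fin 3)).sepVec (Φ.flow s z i).1 (Φ.flow s z j).1‖ ∧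
          ‖(Torus.geometry (Fin 3)).sepVec (Φ.flow s z i).1 (Φ.flow s z j).1‖ < 2 * hsDiameter σ N ∧
          (Φ.flow s z i).2 = c.preVel.1 ∧ (Φ.flow s z j).2 = c.preVel.2 :=
  fun _ _ _ _ hz hσ hε8 _ _ _ _ _ hp hc hgc hg hiso _ hs => isoShell_leg hz hσ hε8 hp hc hgc hg rfl hiso hs

end Legs

end Summit.AtomisticToContinuum.HydrodynamicLimit.Theorems.ClampedTransferCoin.SketchLine

end
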